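import Summits.ResolutionOfSingularities.ResolutionOfSingularities.Theorems.TwistCutOperators
import HarnessLib

/-!
# TwistCutLaw — decomp-res node «TwistCut» (lens-6 g21, critic row 159), tree file 2/3 of the node

Content VERBATIM from the decomp-res lens-6 g21 node `HOME/decomp-res-lens-6/g21/TwistCut.lean` (pin facffb9d, 779 l;
HOME = run/shared/lean/pub/decomp-res; node farm rc 0 · 0 warn · 0 sorry · standard axioms; imports TREE ONLY:
`Theorems.SubfieldContactAbs` +
seven `Literature/AlgebraicGeometry/Resolution` modules; ONE namespace `…Theorems.TwistCutClasses`; no carried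
block).  Critic: CRITIC-LEDGER
row 159 (2026-08-31T00:42:09Z): DECIDED-MOD-PORT(M+) +1 · MAP 0 — THE TWIST LAW in kernel on a typed sub-cell of
`E1TopNoAbs` (item 26971), own
axis; the twisted-Fermat inhabitant decided; residual certificates incl. the sharp TAME near point; port
`WildPointElimination` honest bookkeeping.
Landing order INBOX :591 (critic) / NODE-g21 §6 (lens-6): `--kind proof --supports
stmt-ResolutionOfSingularities-26971`, canonical headers,
three files `TwistCutOperators` (§1–§5: the symbolic-power order law for differential operators, commutator algebra,
transport along ring isos,
coefficient operators on polynomial rings, chart algebra) · `TwistCutLaw` (§6–§7: the three algebraic steps and THE TWIST LAW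
`not_near_of_diffSplit` at scheme level) · `TwistCutCells` (§8–§9: the cells `DiffSplitAt` / `NoNearPointOver` /
`TopNonSplit` / `WORTopNonSplit` /
`WORTopOnlySplit` / `E1TopNonSplit` / `E1TopOnlySplit`, the EXACT carve `e1TopNoAbs_iff_nonSplit_onlySplit`, the
port `WildPointElimination`, the
decided chain `worTopOnlySplit_of_allAbs_of_elimination` / `e1TopNoAbs_iff_e1TopNonSplit(_of_five)` /
`e_one_of_nonSplit`, and the field-level
inhabitant certificates).  Aside bookkeeping (row 159 / INBOX :591): on the lens-6 column ONE port item
`WildPointElimination` (∀ n ≥ 1) and ONE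
successor aside `E1TopNonSplit` SUPERSEDING `E1TopNoAbs` (26971) with the mod-port reading; the decided cell
`E1TopOnlySplit` is not filed.
The lens-6 rev1 companion `TwistCutElim.lean` (868dfb91; the port discharged modulo `BaseStable` ∧
`WildSplitFinite`) awaits the critic.

## This file

§6 the three algebraic steps of the law over generic rings (`section Steps`, `section PolyChart`: `chart_expansion`
… `twist_contradiction`) and §7 THE TWIST LAW at scheme level **`not_near_of_diffSplit`** — blow up a regular `X` in
the CLOSED point `π y` (regular point-centre, r.s.o.p. `c₁ … c_d`); if `f ∈ 𝓘_x`, `f ≡ Σ_{e ∈ E} a_e c^e mod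
𝔪^{n+1}` with all pure powers indexed and for EVERY direction `i` an ABSOLUTE differential operator `δ_i` of order
`≤ n − 1` on `κ(x)` splits the residue coefficient vector (`δ_i(ā_e) = [e = n·ε_i]`), then the weight-`n` controlled
transform is NOT in `𝔪_y^n`: a differentially split top point has NO NEAR POINT.  Imports `TwistCutOperators`.

[WRITER NOTE (decomp-res writer g9): file split only (tree files ≤ 400 lines); namespace, universe, sections,
section variables / opens and
every declaration exactly as in the lens; the only edits are DOCSTRING-ONLY: kind tags on `E1TopNonSplit` /
`E1TopOnlySplit` (INBOX :591), a docstring for `polyChartEquiv`, and the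
lens's global dupNamespace-linter line dropped (no duplicate namespace component in the tree file names).]

(Sources: EGAIV4 16.8.2, 16.8.8; Matsumura1987 §26, Thm 30.6; Villamayor2008 Def. 3.3 (arXiv:math/0606796);
BenitoVillamayor2012 (arXiv:1004.1803); BGMW §3.1; CossartJannsenSaito2020 Def. 3.13, §4, Thm 1.4;
CossartPiltant2019; Giraud1975; Hironaka1970Additive; Moh1987.)
-/

noncomputable section

open CategoryTheory AlgebraicGeometry TopologicalSpace IsLocalRing
open Literature.AlgebraicGeometry.Resolution

universe u

namespace Summit.ResolutionOfSingularities.ResolutionOfSingularities.Theorems.TwistCutClasses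

section Steps

/-! ## §6 The three algebraic steps of the law (generic rings: no scheme unfolding) -/

/-- The restriction of an exponent vector `e : Fin d → ℕ` to the indices `j ≠ i` (exponents of the chart variables). -/
def restrictExp {d : ℕ} (i : Fin d) (e : Fin d → ℕ) : {j : Fin d // j ≠ i} →₀ ℕ :=
  Finsupp.equivFunOnFinite.symm fun j => e j.1

/-- `restrictExp_apply`: Auxiliary step of this node's calculus, VERBATIM from the lens file (see the module
docstring); the statement is its type. [folklore] -/
@[simp] theorem restrictExp_apply {d : ℕ} (i : Fin d) (e : Fin d → ℕ) (j : {j : Fin d // j ≠ i}) :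
    restrictExp i e j = e j.1 := by
  simp [restrictExp]

/-- `restrictExp_single`: Auxiliary step of this node's calculus, VERBATIM from the lens file (see the module
docstring); the statement is its type. [folklore] -/
theorem restrictExp_single {d : ℕ} (i : Fin d) (n : ℕ) : restrictExp i (Pi.single i n) = 0 := by
  ext j
  rw [restrictExp_apply, Pi.single_eq_of_ne j.2, Finsupp.coe_zero, Pi.zero_apply]

/-- STEP 1 (chart expansion): `σ f = σ(cᵢ)^n · (χ G + σ(cᵢ) χ b₀)` with `G = Σ φ(a_e) ∏_{j≠i} e_j^{e_j}`, for any `χ : B_i → S`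
over `σ : R → S` (`χ ∘ φ = σ`). [folklore; StacksProject 0804] [folklore] -/
theorem chart_expansion {R S : Type*} [CommRing R] [CommRing S] {d : ℕ} (c : Fin d → R) (i : Fin d)
    (σ : R →+* S) (χ : chartRing c i →+* S) (hχ : ∀ r, χ (chartBase c i r) = σ r)
    {n : ℕ} {f : R} (E : Finset (Fin d → ℕ)) (hE : ∀ e ∈ E, ∑ j, e j = n) (a : (Fin d → ℕ) → R)
    (hfa : f - ∑ e ∈ E, a e * ∏ j, c j ^ e j ∈ Ideal.span (Set.range c) ^ (n + 1)) :
    ∃ b₀ : chartRing c i, σ f = σ (c i) ^ n *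
      (χ (∑ e ∈ E, chartBase c i (a e) * monProd (fun j : {j : Fin d // j ≠ i} => chartGen c i j.1) (fun j => e j.1)) +
        σ (c i) * χ b₀) := by
  classical
  obtain ⟨b₀, hb₀⟩ := Ideal.mem_span_singleton'.mp
    (map_pow_span_le (chartBase c i) c i (fun r hr => reesChartBase_mem_span_of_mem c i hr) (n + 1)
      (Ideal.mem_map_of_mem (chartBase c i) hfa))
  refine ⟨b₀, ?_⟩
  have hterm : ∀ e ∈ E, chartBase c i (a e * ∏ j, c j ^ e j) =
      chartBase c i (a e) * (chartBase c i (c i ^ n) * monProd (fun j : {j : Fin d // j ≠ i} => chartGen c i j.1) (fun j => e j.1)) :=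
    fun e he => (map_mul (chartBase c i) _ _).trans
      (congrArg (fun w => chartBase c i (a e) * w) (chartBase_prod_pow c i e (hE e he)))
  have hχtn : χ (chartBase c i (c i ^ n)) = σ (c i) ^ n := by rw [hχ, map_pow]
  have hS : σ (∑ e ∈ E, a e * ∏ j, c j ^ e j) = σ (c i) ^ n *
      χ (∑ e ∈ E, chartBase c i (a e) * monProd (fun j : {j : Fin d // j ≠ i} => chartGen c i j.1) (fun j => e j.1)) := by
    rw [← hχ]
    simp only [map_sum, Finset.mul_sum]
    refine Finset.sum_congr rfl fun e he => ?_
    rw [hterm e he, map_mul, map_mul, map_mul, hχtn]; ring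
  have hr : σ (f - ∑ e ∈ E, a e * ∏ j, c j ^ e j) = σ (c i) ^ n * (σ (c i) * χ b₀) := by
    rw [← hχ (f - _), ← hb₀, map_mul, pow_succ, map_mul, map_mul, hχtn, hχ]; ring
  have h1 : σ f = σ (∑ e ∈ E, a e * ∏ j, c j ^ e j) + σ (f - ∑ e ∈ E, a e * ∏ j, c j ^ e j) := by
    rw [← map_add]; congr 1; ring
  rw [h1, hS, hr]; ring

/-- STEP 2 (localisation): if `G ↦ w₁ - k u` in `S = B_𝔴` with `w₁ ∈ 𝔪_S^n`, then `s G ∈ 𝔴^n + (k)` for some `s ∉ 𝔴`.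
[folklore; AtiyahMacdonald1969 Prop. 3.11] [folklore] -/
theorem exists_mul_mem_sup_of_localization {B S : Type*} [CommRing B] [CommRing S] [Algebra B S] [IsLocalRing S]
    (𝔴 : Ideal B) [𝔴.IsPrime] [IsLocalization.AtPrime S 𝔴] {n : ℕ} (G k : B) (u w₁ : S)
    (hG : algebraMap B S G = w₁ - algebraMap B S k * u) (hw₁ : w₁ ∈ maximalIdeal S ^ n) :
    ∃ s ∉ 𝔴, s * G ∈ 𝔴 ^ n ⊔ Ideal.span {k} := by
  have hmax : 𝔴.map (algebraMap B S) = maximalIdeal S := IsLocalization.AtPrime.map_eq_maximalIdeal 𝔴 S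
  have hGmem : algebraMap B S G ∈ (𝔴 ^ n ⊔ Ideal.span {k}).map (algebraMap B S) := by
    rw [Ideal.map_sup, Ideal.map_pow, hmax, Ideal.map_span, Set.image_singleton, hG]
    exact sub_mem (Ideal.mem_sup_left hw₁)
      (Ideal.mem_sup_right (Ideal.mul_mem_right _ _ (Ideal.mem_span_singleton_self _)))
  obtain ⟨s, hs, hsG⟩ := (IsLocalization.algebraMap_mem_map_algebraMap_iff 𝔴.primeCompl S _ _).mp hGmem
  exact ⟨s, hs, hsG⟩

/-- `κ[T_j : j ≠ i] ≃ B_i/(cᵢ)`: the special fibre of the chart `D₊(cᵢt)` as a polynomial ring over the RESIDUE FIELD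
(`chartQuotEquiv` = StacksProject 0BIQ, with coefficients moved from `R/(c)` to `κ = R/𝔪` along `(c) = 𝔪`). -/
def residueEquiv {R : Type*} [CommRing R] [IsLocalRing R] {d : ℕ} (c : Fin d → R)
    (hc : Ideal.span (Set.range c) = maximalIdeal R) : ResidueField R ≃+* (R ⧸ Ideal.span (Set.range c)) :=
  Ideal.quotEquivOfEq hc.symm

/-- `residueEquiv_residue`: Auxiliary step of this node's calculus, VERBATIM from the lens file (see the module
docstring); the statement is its type. [folklore] -/
theorem residueEquiv_residue {R : Type*} [CommRing R] [IsLocalRing R] {d : ℕ} (c : Fin d → R)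
    (hc : Ideal.span (Set.range c) = maximalIdeal R) (r : R) :
    residueEquiv c hc (residue R r) = Ideal.Quotient.mk _ r :=
  Ideal.quotEquivOfEq_mk _ _

/-- The chart isomorphism of §6: the polynomial ring over the residue field in the variables `j ≠ i` ≃ the `i`-th
chart ring modulo the exceptional equation `c i` (`mapEquiv (residueEquiv c hc)` followed by `chartQuotEquiv`).
Auxiliary definition of this node's calculus, VERBATIM from the lens file; its characterising lemmas are
`polyChartEquiv_apply` / `polyChartEquiv_C`. -/
def polyChartEquiv {R : Type*} [CommRing R] [IsLocalRing R] {d : ℕ} (c : Fin d → R) (i : Fin d)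
    (hc : Ideal.span (Set.range c) = maximalIdeal R) (hqr : IsQuasiRegular c) :
    MvPolynomial {j : Fin d // j ≠ i} (ResidueField R) ≃+* (chartRing c i ⧸ Ideal.span {chartBase c i (c i)}) :=
  (MvPolynomial.mapEquiv _ (residueEquiv c hc)).trans (chartQuotEquiv c i hqr)

section PolyChart

variable {R : Type*} [CommRing R] [IsLocalRing R] {d : ℕ} (c : Fin d → R) (i : Fin d)
  (hc : Ideal.span (Set.range c) = maximalIdeal R) (hqr : IsQuasiRegular c)

/-- `polyChartEquiv_apply`: Auxiliary step of this node's calculus, VERBATIM from the lens file (see the module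
docstring); the statement is its type. [folklore] -/
theorem polyChartEquiv_apply (q : MvPolynomial {j : Fin d // j ≠ i} (ResidueField R)) :
    polyChartEquiv c i hc hqr q = chartQuotMap c i (MvPolynomial.map (residueEquiv c hc : _ →+* _) q) := by
  change chartQuotEquiv c i hqr (MvPolynomial.map (residueEquiv c hc : _ →+* _) q) = _
  rw [chartQuotEquiv_apply]

/-- `C ā ↦ φ(a) mod cᵢ`. [folklore; StacksProject 0BIQ] [folklore] -/
theorem polyChartEquiv_C (r : R) :
    polyChartEquiv c i hc hqr (MvPolynomial.C (residue R r)) =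
      Ideal.Quotient.mk (Ideal.span {chartBase c i (c i)}) (chartBase c i r) := by
  rw [polyChartEquiv_apply, MvPolynomial.map_C]
  change chartQuotMap c i (MvPolynomial.C (residueEquiv c hc (residue R r))) = _
  rw [residueEquiv_residue, chartQuotMap_C]

/-- `T_j ↦ e_j mod cᵢ`. [folklore; StacksProject 0BIQ] [folklore] -/
theorem polyChartEquiv_X (j : {j : Fin d // j ≠ i}) :
    polyChartEquiv c i hc hqr (MvPolynomial.X j) =
      Ideal.Quotient.mk (Ideal.span {chartBase c i (c i)}) (chartGen c i j.1) := by
  rw [polyChartEquiv_apply, MvPolynomial.map_X, chartQuotMap_X]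

/-- `T^{e|_{j≠i}} ↦ ∏_{j≠i} e_j^{e_j} mod cᵢ`. [folklore; StacksProject 0BIQ] [folklore] -/
theorem polyChartEquiv_monomial_one (e : Fin d → ℕ) :
    polyChartEquiv c i hc hqr (MvPolynomial.monomial (restrictExp i e) 1) =
      Ideal.Quotient.mk (Ideal.span {chartBase c i (c i)})
        (monProd (fun j : {j : Fin d // j ≠ i} => chartGen c i j.1) (fun j => e j.1)) := by
  classical
  rw [polyChartEquiv_apply, MvPolynomial.map_monomial, map_one, chartQuotMap, MvPolynomial.eval₂Hom_monomial, map_one,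
    one_mul, Finsupp.prod_fintype _ _ (fun j => pow_zero _), monProd, map_prod]
  refine Finset.prod_congr rfl fun j _ => ?_
  rw [restrictExp_apply, map_pow]

/-- One term: `ā_e T^{e|} ↦ φ(a_e) ∏ e_j^{e_j} mod cᵢ`. [folklore] -/
theorem polyChartEquiv_term (a : (Fin d → ℕ) → R) (e : Fin d → ℕ) :
    polyChartEquiv c i hc hqr (MvPolynomial.monomial (restrictExp i e) (residue R (a e))) =
      Ideal.Quotient.mk (Ideal.span {chartBase c i (c i)})
        (chartBase c i (a e) * monProd (fun j : {j : Fin d // j ≠ i} => chartGen c i j.1) (fun j => e j.1)) := by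
  have h1 : MvPolynomial.monomial (restrictExp i e) (residue R (a e)) =
      MvPolynomial.C (residue R (a e)) * MvPolynomial.monomial (restrictExp i e) 1 := by
    rw [MvPolynomial.C_mul_monomial, mul_one]
  rw [h1, map_mul (polyChartEquiv c i hc hqr), polyChartEquiv_C, polyChartEquiv_monomial_one,
    ← map_mul (Ideal.Quotient.mk (Ideal.span {chartBase c i (c i)}))]

/-- The sum: `Σ ā_e T^{e|} ↦ G mod cᵢ`. [folklore] -/
theorem polyChartEquiv_sum (E : Finset (Fin d → ℕ)) (a : (Fin d → ℕ) → R) :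
    polyChartEquiv c i hc hqr (∑ e ∈ E, MvPolynomial.monomial (restrictExp i e) (residue R (a e))) =
      Ideal.Quotient.mk (Ideal.span {chartBase c i (c i)})
        (∑ e ∈ E, chartBase c i (a e) * monProd (fun j : {j : Fin d // j ≠ i} => chartGen c i j.1) (fun j => e j.1)) := by
  rw [map_sum (polyChartEquiv c i hc hqr) _ E, map_sum (Ideal.Quotient.mk (Ideal.span {chartBase c i (c i)})) _ E]
  exact Finset.sum_congr rfl fun e _ => polyChartEquiv_term c i hc hqr a e

end PolyChart

/-- The coefficient operator of a SPLITTING operator `δᵢ` sends `Σ ā_e T^{e|}` to `1`. [new; elementary] [folklore] -/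
theorem coeffOp_sum_eq_one {K : Type*} [CommRing K] {d : ℕ} (i : Fin d) {n : ℕ} (E : Finset (Fin d → ℕ))
    (hEi : Pi.single i n ∈ E) (ab : (Fin d → ℕ) → K) (δ : K →ₗ[ℤ] K)
    (hδa : ∀ e ∈ E, δ (ab e) = if e = Pi.single i n then 1 else 0) :
    coeffOp δ (∑ e ∈ E, MvPolynomial.monomial (restrictExp i e) (ab e)) = 1 := by
  classical
  have h1 : ∀ e ∈ E, coeffOp δ (MvPolynomial.monomial (restrictExp i e) (ab e)) =
      if e = Pi.single i n then MvPolynomial.monomial (restrictExp i e) (1 : K) else 0 := by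
    intro e he
    rw [coeffOp_monomial, hδa e he]
    split_ifs with h
    · rfl
    · exact map_zero _
  rw [map_sum (coeffOp δ) _ E, Finset.sum_congr rfl h1, Finset.sum_ite_eq' E (Pi.single i n), if_pos hEi,
    restrictExp_single]
  rfl

/-- STEP 3 (the operator on `B/(cᵢ) ≅ κ[T_j : j ≠ i]`): a differentially split coefficient vector forbids
`s G ∈ 𝔴^n + (cᵢ)` with `s ∉ 𝔴 ∋ cᵢ`. [new; tools: StacksProject 0BIQ (`chartQuotEquiv`), EGAIV4 §16.8] [folklore] -/
theorem twist_contradiction {R : Type*} [CommRing R] [IsLocalRing R] {d : ℕ} (c : Fin d → R) (i : Fin d)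
    (hc : Ideal.span (Set.range c) = maximalIdeal R) (hqr : IsQuasiRegular c)
    {n : ℕ} (hn : 1 ≤ n) (E : Finset (Fin d → ℕ)) (a : (Fin d → ℕ) → R) (hEi : Pi.single i n ∈ E)
    (δ : ResidueField R →ₗ[ℤ] ResidueField R) (hδ : IsDiffOpLE ℤ (n - 1) δ)
    (hδa : ∀ e ∈ E, δ (residue R (a e)) = if e = Pi.single i n then 1 else 0)
    (𝔴 : Ideal (chartRing c i)) [𝔴.IsPrime] (hK𝔴 : chartBase c i (c i) ∈ 𝔴) {s : chartRing c i} (hs : s ∉ 𝔴)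
    (hsG : s * (∑ e ∈ E, chartBase c i (a e) * monProd (fun j : {j : Fin d // j ≠ i} => chartGen c i j.1) (fun j => e j.1)) ∈
      𝔴 ^ n ⊔ Ideal.span {chartBase c i (c i)}) : False := by
  classical
  obtain ⟨G, hG⟩ : ∃ G : chartRing c i,
      G = ∑ e ∈ E, chartBase c i (a e) * monProd (fun j : {j : Fin d // j ≠ i} => chartGen c i j.1) (fun j => e j.1) :=
    ⟨_, rfl⟩
  obtain ⟨K𝔷, hK𝔷⟩ : ∃ K𝔷 : Ideal (chartRing c i), K𝔷 = Ideal.span {chartBase c i (c i)} := ⟨_, rfl⟩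
  rw [← hG, ← hK𝔷] at hsG
  have hK𝔴' : K𝔷 ≤ 𝔴 := by rw [hK𝔷, Ideal.span_singleton_le_iff_mem]; exact hK𝔴
  haveI hQp : (𝔴.map (Ideal.Quotient.mk K𝔷)).IsPrime :=
    Ideal.map_isPrime_of_surjective Ideal.Quotient.mk_surjective (by rw [Ideal.mk_ker]; exact hK𝔴')
  have hsQ : Ideal.Quotient.mk K𝔷 s ∉ 𝔴.map (Ideal.Quotient.mk K𝔷) := by
    rw [Ideal.mem_quotient_iff_mem_sup, sup_eq_left.mpr hK𝔴']; exact hs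
  have hsGQ : Ideal.Quotient.mk K𝔷 s * Ideal.Quotient.mk K𝔷 G ∈ (𝔴.map (Ideal.Quotient.mk K𝔷)) ^ n := by
    rw [← map_mul]
    have := Ideal.mem_map_of_mem (Ideal.Quotient.mk K𝔷) hsG
    rwa [Ideal.map_sup, Ideal.map_pow, Ideal.map_quotient_self, sup_bot_eq] at this
  subst hK𝔷
  -- the operator `δ ⊗ id` on `κ[T]`, transported to `B/(cᵢ)` along `polyChartEquiv`
  have hεG : polyChartEquiv c i hc hqr (∑ e ∈ E, MvPolynomial.monomial (restrictExp i e) (residue R (a e))) =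
      Ideal.Quotient.mk _ G := by
    rw [hG]; exact polyChartEquiv_sum c i hc hqr E a
  have hD : IsDiffOpLE ℤ (n - 1) (conj (polyChartEquiv c i hc hqr) (coeffOp δ)) :=
    IsDiffOpLE.conj _ (IsDiffOpLE.coeffOp hδ)
  have hD1 : conj (polyChartEquiv c i hc hqr) (coeffOp δ) (Ideal.Quotient.mk _ G) = 1 := by
    rw [conj_apply, ← hεG, RingEquiv.symm_apply_apply, coeffOp_sum_eq_one i E hEi (fun e => residue R (a e)) δ hδa,
      map_one]
  exact IsDiffOpLE.apply_ne_one_of_mul_mem_pow _ (show n - 1 < n by omega) hD hsQ hsGQ hD1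

end Steps

section Law

variable {X X' : Scheme.{u}} {π : X' ⟶ X} {C : X.IdealSheafData}

/-! ## §7 THE TWIST LAW (scheme level): a differentially split top point has no near point -/

set_option maxHeartbeats 400000 in
/-- **THE TWIST LAW (kernel, every characteristic, every field).**  Let `π : X' → X` be the blow-up of the regular scheme `X`
at the reduced closed point `x = π y` (`C` regular, `supp C = {x}`), `(c₁, …, c_d)` a regular system of parameters at `x`, and
`f ∈ 𝓘_x` with `f ≡ Σ_{e ∈ E} a_e c^e  (mod 𝔪_x^{n+1})`, all `|e| = n ≥ 1`, the pure powers `cᵢ^n` indexed in `E`.  Suppose the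
coefficient vector `(ā_e)_e` in the residue field `κ(x)` is DIFFERENTIALLY SPLIT: for every `i` some ABSOLUTE differential
operator `δᵢ ∈ Diff^{≤ n-1}_ℤ(κ(x))` has `δᵢ(ā_e) = [e = n·εᵢ]`.  Then `y` is NOT a near point:
`𝓘'_y ⊄ 𝔪_y^n` for the controlled transform `𝓘' = (π^*𝓘 : 𝓔^n)`.
Proof: on the chart `D₊(cᵢt) ∋ y`, `π^*f = cᵢ^n (G + cᵢ b₀)` with `G = Σ φ(a_e) ∏_{j≠i} e_j^{e_j}` (`chart_expansion`); nearness
gives `s G ∈ 𝔴^n + (cᵢ)` for some `s ∉ 𝔴` (`𝒪_y = B_𝔴`, `exists_mul_mem_sup_of_localization`); modulo `cᵢ` the chart ring is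
the polynomial ring `κ(x)[T_j : j ≠ i]` (StacksProject 0BIQ, `chartQuotEquiv`), `G ↦ Σ ā_e T^{e|_{j≠i}}`, and the coefficient
operator `δᵢ ⊗ id` (order `≤ n-1`, `IsDiffOpLE.coeffOp`, transported by `IsDiffOpLE.conj`) sends it to `1`; but an operator of
order `< n` maps the symbolic power `𝔴̄^{(n)}` into `𝔴̄` (`IsDiffOpLE.apply_mem_of_mul_mem_pow`) — `twist_contradiction`.
(Sources: EGAIV4 §16.8; StacksProject 0804, 0BIQ; CossartJannsenSaito2020 Def. 3.13 / Thm. 3.14 («near points»);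
Giraud1975 and CossartPiltant2008 Thm. 2.1 for the rôle of the imperfect residue field.) -/
theorem not_near_of_diffSplit (hπ : IsBlowup π C) (hX : Scheme.IsRegular X) (hCreg : Scheme.IsRegular C.subscheme)
    (I : X.IdealSheafData) (y : X') (hcl : IsClosed ({π.base y} : Set X)) (hpt : (C.support : Set X) = {π.base y})
    {d : ℕ} (c : Fin d → X.presheaf.stalk (π.base y)) (hd : (maximalIdeal (X.presheaf.stalk (π.base y))).spanFinrank = d)
    (hc : Ideal.span (Set.range c) = maximalIdeal (X.presheaf.stalk (π.base y)))
    {n : ℕ} (hn : 1 ≤ n) {f : X.presheaf.stalk (π.base y)} (hfI : f ∈ stalkIdeal I (π.base y))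
    (E : Finset (Fin d → ℕ)) (hE : ∀ e ∈ E, ∑ j, e j = n) (a : (Fin d → ℕ) → X.presheaf.stalk (π.base y))
    (hfa : f - ∑ e ∈ E, a e * ∏ j, c j ^ e j ∈ maximalIdeal (X.presheaf.stalk (π.base y)) ^ (n + 1))
    (hEi : ∀ i, Pi.single i n ∈ E)
    (hsplit : ∀ i : Fin d, ∃ δ : ResidueField (X.presheaf.stalk (π.base y)) →ₗ[ℤ] ResidueField (X.presheaf.stalk (π.base y)),
      IsDiffOpLE ℤ (n - 1) δ ∧ ∀ e ∈ E, δ (residue _ (a e)) = if e = Pi.single i n then 1 else 0) :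
    ¬ stalkIdeal (controlledTransform π C I n) y ≤ maximalIdeal (X'.presheaf.stalk y) ^ n := by
  classical
  intro hle
  haveI : IsRegularLocalRing (X.presheaf.stalk (π.base y)) := hX _
  -- the centre stalk is `𝔪_x`
  have hCst : stalkIdeal C (π.base y) = maximalIdeal _ := by
    rw [eq_vanishingIdeal_support_of_isRegular C hCreg]
    apply stalkIdeal_vanishingIdeal_eq_maximalIdeal_of_closure_eq
    rw [hpt, hcl.closure_eq]
  have hcC : Ideal.span (Set.range c) = stalkIdeal C (π.base y) := hc.trans hCst.symm
  -- the chart at `y`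
  obtain ⟨i, 𝔴, χ, hχ, hloc, h𝔴⟩ := hπ.exists_reesChart_stalk y c hcC
  letI alg : Algebra (chartRing c i) (X'.presheaf.stalk y) := χ.toAlgebra
  haveI : IsLocalization.AtPrime (X'.presheaf.stalk y) 𝔴.asIdeal := hloc
  have halg : ∀ b, algebraMap (chartRing c i) (X'.presheaf.stalk y) b = χ b := fun b => by
    rw [RingHom.algebraMap_toAlgebra]
  have hg : ∀ j, chartBase c i (c j) = chartBase c i (c i) * chartGen c i j := fun j =>
    reesChartBase_apply_eq_mul_chartGen c i j
  -- `E_y = (t)`, `t = π^* cᵢ`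
  have hE𝔷 : stalkIdeal (C.comap π) y = Ideal.span {(π.stalkMap y).hom (c i)} := by
    rw [stalkIdeal_comap_eq_map_stalkMap, hCst, ← hc, Ideal.map_span]
    apply le_antisymm
    · rw [Ideal.span_le]
      rintro _ ⟨_, ⟨j, rfl⟩, rfl⟩
      change (π.stalkMap y).hom (c j) ∈ Ideal.span {(π.stalkMap y).hom (c i)}
      rw [← hχ (c j), hg j, map_mul, hχ]
      exact Ideal.mul_mem_right _ _ (Ideal.mem_span_singleton_self _)
    · rw [Ideal.span_singleton_le_iff_mem]
      exact Ideal.subset_span ⟨c i, ⟨i, rfl⟩, rfl⟩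
  -- colon formula for the controlled transform
  have hI' : stalkIdeal (controlledTransform π C I n) y =
      Submodule.colon ((stalkIdeal I (π.base y)).map (π.stalkMap y).hom) {(π.stalkMap y).hom (c i) ^ n} := by
    rw [hπ.stalkIdeal_controlledTransform I n y, stalkIdeal_comap_eq_map_stalkMap, hE𝔷, Ideal.span_singleton_pow,
      Submodule.colon_span]
  -- STEP 1: the chart expansion, in `𝒪_y`
  obtain ⟨G, hG⟩ : ∃ G : chartRing c i,
      G = ∑ e ∈ E, chartBase c i (a e) * monProd (fun j : {j : Fin d // j ≠ i} => chartGen c i j.1) (fun j => e j.1) :=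
    ⟨_, rfl⟩
  have hfa' : f - ∑ e ∈ E, a e * ∏ j, c j ^ e j ∈ Ideal.span (Set.range c) ^ (n + 1) := by rw [hc]; exact hfa
  obtain ⟨b₀, hσf⟩ := chart_expansion c i (π.stalkMap y).hom χ hχ E hE a hfa'
  rw [← hG] at hσf
  -- nearness: `w₁ = χ G + t χ b₀ ∈ 𝓘'_y ⊆ 𝔪_y^n`
  have hw₁I : χ G + (π.stalkMap y).hom (c i) * χ b₀ ∈ stalkIdeal (controlledTransform π C I n) y := by
    rw [hI', Submodule.mem_colon_singleton, smul_eq_mul, mul_comm, ← hσf]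
    exact Ideal.mem_map_of_mem _ hfI
  have hw₁n : χ G + (π.stalkMap y).hom (c i) * χ b₀ ∈ maximalIdeal (X'.presheaf.stalk y) ^ n := hle hw₁I
  -- STEP 2: `s G ∈ 𝔴^n + (cᵢ)`, `s ∉ 𝔴`
  obtain ⟨s, hs, hsG⟩ :=
    exists_mul_mem_sup_of_localization (S := X'.presheaf.stalk y) 𝔴.asIdeal G (chartBase c i (c i)) (χ b₀)
      (χ G + (π.stalkMap y).hom (c i) * χ b₀) (by rw [halg, halg, hχ]; ring) hw₁n
  -- STEP 3
  have hK𝔴 : chartBase c i (c i) ∈ 𝔴.asIdeal := by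
    rw [← Ideal.mem_comap, h𝔴, ← hc]
    exact Ideal.subset_span ⟨i, rfl⟩
  rw [hG] at hsG
  obtain ⟨δ, hδ, hδa⟩ := hsplit i
  exact twist_contradiction c i hc (isQuasiRegular_rsop_comp hd c hc id Function.injective_id) hn E a (hEi i) δ hδ hδa
    𝔴.asIdeal hK𝔴 hs hsG

end Law

end Summit.ResolutionOfSingularities.ResolutionOfSingularities.Theorems.TwistCutClasses
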